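import Summits.Ventures.Crystal3D.Theorems.StickyWulffConstantGenericWallFloorStackLedgerLocalSep
import HarnessLib

/-!
# The PAYER-POOL form of the separated two-family stack ledger: `(κ₁+κ₂)πρ² − 4000(1+h)ρ ≤ Σ_PAY (12 − deg)`, uniform numeric constant
# (crux `GenericWallFloor`, stmt-Ventures-19480, line `WallLedgerG`; debt G-U for lane T, cf-p1 (xlv⁗) 2026-08-28T22:21Z / order (2) 22:31Z)

HONEST FRAMING. Venture `Summits/Ventures/Crystal3D` (cell `crystal3d-full`), helper `--supports` the crux `GenericWallFloor`
(stmt-Ventures-19480) of `route-Ventures-StickyWulffConstant`, registered line `WallLedgerG`, open stub `stub_twoSlabAdhesion`.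
Rung credit only; F-C1 not moved; NOT the stub.  Inputs BY NAME as in `twoSlabAdhesion_stackLedger_local_sep`: E1 (`hcert`), `DoubleStarCoaxialAt` /
`CapPairCoaxial` (= `StarPairFar`).

WHY.  Lane T consumes wall cells only with constants UNIFORM in the plate pair (wulff-p2's Q-T′: R1), in the exact-bond currency of
`BilayerWallAt`, through `bilayerWallAt_of_payerBound` (`…TextureLiminfBilayerWallBookkeeping`), whose single input is a PAYER-POOL
inequality `2Q ≤ Σ_{PAY} (12 − deg) + C'(1+h)ρ` over the ledger's payer window.  The landed `twoSlabAdhesion_stackLedger_local_sep` concludes the ADHESION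
form, whose conversion passes through `affineSampleDeficit_upper` (constant `K²/|⟪w, A⁻¹e₃⟫|`, NOT uniform in the orientation).  But its
internal main estimate IS a payer-pool inequality with a NUMERIC constant: this file exports exactly that step, verbatim from the landed
proof, so the (β) import of lane T's `fam*Fcc` stubs (non-co-axial registered fcc pairs sorted by `hgen`) can be fed to
`bilayerWallAt_of_payerBound` with pair-free constants (thickness `R₀ = 10` here; T re-anchors thicker plates onto this window since the
statement is uniform in the translations).
* **`payerPool_local_sep`** — separated frame sets `M₁`, `M₂` (no frame of one co-axial with a frame of the other), steep slots `u₁` up / `u₂` down, vertical `±e₃`; for every cell of thickness `10` (hypotheses verbatim, `R₀ = 10` literal):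
  `(κ₁ + κ₂)·π·ρ² − 4000·(1+h)·ρ ≤ Σ_{y ∈ PAY} (12 − deg y)`, `κᵢ = √2|⟪Aᵢuᵢ, e₃⟫|`, `PAY` = unsaturated balls with
  `−12 ≤ y₂ ≤ h + 12` — NO `φ`, NO face count, constant `4000` independent of `(A₁, t₁, A₂, t₂)`.
WHAT THIS IS NOT: not the stub; registered translations / ray-aligned pairs not covered; the T-side re-anchoring and the
`stacking`-presentation of fcc plates are lane T's glue; F-C1 not moved.
-/

noncomputable section

namespace Summit.Ventures.Crystal3D.Theorems

open Summit.Ventures.Crystal3D Finset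
open Literature.MathematicalPhysics.StatisticalMechanics (fccStacking barlowStacking IsHaggSeq contactDeficiency)
open scoped InnerProductSpace

open scoped Classical in
/-- **PAYER-POOL form of `twoSlabAdhesion_stackLedger_local_sep`** (uniform numeric constant, thickness `10`): see the module docstring. -/
theorem payerPool_local_sep
    {s₀ : EuclideanSpace ℝ (Fin 3)} (hs₀ : s₀ ∈ fccSlots)
    (hcert : ExactOnly 0 (fccSlots.filter fun w => 0 < ⟪w, s₀⟫_ℝ))
    (hDS : ∀ F₁ F₂ : EuclideanSpace ℝ (Fin 3) ≃ₗᵢ[ℝ] EuclideanSpace ℝ (Fin 3), DoubleStarCoaxialAt F₁ F₂)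
    (hCP : CapPairCoaxial)
    (A₁ : EuclideanSpace ℝ (Fin 3) ≃ₗᵢ[ℝ] EuclideanSpace ℝ (Fin 3)) (t₁ : EuclideanSpace ℝ (Fin 3))
    (A₂ : EuclideanSpace ℝ (Fin 3) ≃ₗᵢ[ℝ] EuclideanSpace ℝ (Fin 3)) (t₂ : EuclideanSpace ℝ (Fin 3))
    {u₁ : EuclideanSpace ℝ (Fin 3)} (hu₁ : u₁ ∈ fccSlots)
    (hsteep₁ : Real.sqrt 2 / 2 ≤ ⟪A₁ u₁, EuclideanSpace.single (2 : Fin 3) (1 : ℝ)⟫_ℝ)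
    {u₂ : EuclideanSpace ℝ (Fin 3)} (hu₂ : u₂ ∈ fccSlots)
    (hsteep₂ : ⟪A₂ u₂, EuclideanSpace.single (2 : Fin 3) (1 : ℝ)⟫_ℝ ≤ -(Real.sqrt 2 / 2))
    (M₁ M₂ : Set (EuclideanSpace ℝ (Fin 3) ≃ₗᵢ[ℝ] EuclideanSpace ℝ (Fin 3)))
    (hM₁ : ∀ stk : List WalkEntry, StackSound (EuclideanSpace.single (2 : Fin 3) (1 : ℝ)) stk →
      StackWF (EuclideanSpace.single (2 : Fin 3) (1 : ℝ)) stk → stk.getLast? = some ⟨A₁, u₁, 0⟩ →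
      ∀ e ∈ stk, e.frame ∈ M₁)
    (hM₂ : ∀ stk : List WalkEntry, StackSound (-EuclideanSpace.single (2 : Fin 3) (1 : ℝ)) stk →
      StackWF (-EuclideanSpace.single (2 : Fin 3) (1 : ℝ)) stk → stk.getLast? = some ⟨A₂, u₂, 0⟩ →
      ∀ e ∈ stk, e.frame ∈ M₂)
    (hsep : ∀ F₁ ∈ M₁, ∀ F₂ ∈ M₂, ¬ ∃ (L : EuclideanSpace ℝ (Fin 3) ≃ₗᵢ[ℝ] EuclideanSpace ℝ (Fin 3))
        (s₁ s₂ : EuclideanSpace ℝ (Fin 3)) (σ σ' : ℤ → ℤ), IsHaggSeq σ ∧ IsHaggSeq σ' ∧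
        F₁ '' fccStacking 1 (Real.sqrt (2 / 3)) ⊆ (fun p => L p + s₁) '' barlowStacking 1 (Real.sqrt (2 / 3)) σ ∧
        F₂ '' fccStacking 1 (Real.sqrt (2 / 3)) ⊆ (fun p => L p + s₂) '' barlowStacking 1 (Real.sqrt (2 / 3)) σ')
    (h : ℝ) (hh : 0 ≤ h) (ρ : ℝ) (hρ : 10 ≤ ρ) (X P₁ P₂ : Finset (EuclideanSpace ℝ (Fin 3)))
    (hX : ∀ p ∈ X, ∀ q ∈ X, p ≠ q → 1 ≤ dist p q) (hP₁X : P₁ ⊆ X) (hP₂X : P₂ ⊆ X \ P₁)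
    (hcell : ∀ p ∈ X, -(2 * 10) ≤ p 2 ∧ p 2 ≤ h + 2 * 10 ∧ p 0 ^ 2 + p 1 ^ 2 ≤ ρ ^ 2)
    (hP₁ : ∀ p, p ∈ P₁ ↔ (p ∈ (fun q => A₁ q + t₁) '' fccStacking 1 (Real.sqrt (2 / 3)) ∧
      -(2 * 10) ≤ p 2 ∧ p 2 ≤ -10 ∧ p 0 ^ 2 + p 1 ^ 2 ≤ ρ ^ 2))
    (hP₂ : ∀ p, p ∈ P₂ ↔ (p ∈ (fun q => A₂ q + t₂) '' fccStacking 1 (Real.sqrt (2 / 3)) ∧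
      h + 10 ≤ p 2 ∧ p 2 ≤ h + 2 * 10 ∧ p 0 ^ 2 + p 1 ^ 2 ≤ ρ ^ 2)) :
    (Real.sqrt 2 * |⟪A₁ u₁, EuclideanSpace.single (2 : Fin 3) (1 : ℝ)⟫_ℝ| +
      Real.sqrt 2 * |⟪A₂ u₂, EuclideanSpace.single (2 : Fin 3) (1 : ℝ)⟫_ℝ|) * Real.pi * ρ ^ 2 - 2 * 2000 * (1 + h) * ρ ≤
      ∑ y ∈ X.filter (fun y => (X.filter fun q => dist y q = 1).card ≠ 12 ∧ -10 - 2 ≤ y 2 ∧ y 2 ≤ h + 10 + 2),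
        ((12 : ℝ) - ((X.filter fun q => dist y q = 1).card : ℝ)) := by
  set e₃ : EuclideanSpace ℝ (Fin 3) := EuclideanSpace.single (2 : Fin 3) (1 : ℝ) with he₃
  have he₃n : ‖e₃‖ = 1 := by rw [he₃, PiLp.norm_single, norm_one]
  have hme₃n : ‖-e₃‖ = 1 := by rw [norm_neg, he₃n]
  have he₃i : ∀ d : EuclideanSpace ℝ (Fin 3), ⟪d, e₃⟫_ℝ = d 2 := fun d => by rw [he₃, EuclideanSpace.inner_single_right]; simp
  have hsteep₂' : Real.sqrt 2 / 2 ≤ ⟪A₂ u₂, -e₃⟫_ℝ := by rw [inner_neg_right]; linarith only [hsteep₂]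
  -- the two base frames lie in their frame sets (the start stacks are sound and well formed)
  have hA₁M : A₁ ∈ M₁ := hM₁ [⟨A₁, u₁, 0⟩] ⟨hu₁, hsteep₁⟩ rfl rfl ⟨A₁, u₁, 0⟩ (List.mem_singleton_self _)
  have hA₂M : A₂ ∈ M₂ := hM₂ [⟨A₂, u₂, 0⟩] ⟨hu₂, hsteep₂'⟩ rfl rfl ⟨A₂, u₂, 0⟩ (List.mem_singleton_self _)
  set φ₁ : ℝ := Real.sqrt 2 / 4 * ∑ᶠ w ∈ {w ∈ fccStacking 1 (Real.sqrt (2 / 3)) | ‖w‖ = 1},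
      |⟪w, A₁.symm (EuclideanSpace.single (2 : Fin 3) (1 : ℝ))⟫_ℝ| with hφ₁
  set φ₂ : ℝ := Real.sqrt 2 / 4 * ∑ᶠ w ∈ {w ∈ fccStacking 1 (Real.sqrt (2 / 3)) | ‖w‖ = 1},
      |⟪w, A₂.symm (EuclideanSpace.single (2 : Fin 3) (1 : ℝ))⟫_ℝ| with hφ₂
  have hP₂X' : P₂ ⊆ X := hP₂X.trans Finset.sdiff_subset
  obtain ⟨hρ0, hρ1⟩ : (0 : ℝ) ≤ ρ ∧ (1 : ℝ) ≤ ρ := ⟨by linarith, by linarith⟩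
  set L : ℝ := 8 / 3 * (h + 4 * 10) with hL; have hL0 : 0 ≤ L := by rw [hL]; positivity
  set N : ℕ := ⌈3 * (h + 4 * 10 + 1)⌉₊ with hNdef
  set ρs : ℝ := ρ - 3 - 8 / 3 * (h + 4 * 10) with hρs
  set deg : EuclideanSpace ℝ (Fin 3) → ℕ := fun x => (X.filter fun q => dist x q = 1).card with hdeg
  have hdeg12 : ∀ x, deg x ≤ 12 := fun x => card_filter_dist_eq_one_le_twelve X hX x
  set PAY := X.filter fun y => (X.filter fun q => dist y q = 1).card ≠ 12 ∧
    -10 - 2 ≤ y 2 ∧ y 2 ≤ h + 10 + 2 with hPAY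
  -- the weighted interior ledger
  have hled := ledger_ge_faces_add_interior_credits A₁ t₁ A₂ t₂ X P₁ P₂ 10 h ρ le_rfl hh hρ hX hcell hP₁X hP₂X'
    hP₁ hP₂
  rw [← finsum_unit_fcc_symm_eq_sum_slots A₁, ← finsum_unit_fcc_symm_eq_sum_slots A₂, ← hφ₁, ← hφ₂, ← hPAY] at hled
  -- fuel
  have hN : (3 : ℝ) * (h + 4 * 10 + 1) ≤ (N : ℝ) := by rw [hNdef]; exact Nat.le_ceil _
  -- fluxes
  set κ₁ : ℝ := Real.sqrt 2 * |⟪A₁ u₁, e₃⟫_ℝ| with hκ₁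
  set κ₂ : ℝ := Real.sqrt 2 * |⟪A₂ u₂, e₃⟫_ℝ| with hκ₂
  have hsq : 0 ≤ Real.sqrt 2 := Real.sqrt_nonneg 2; have hπ : Real.pi ≤ 4 := Real.pi_le_four; have hπ0 : 0 ≤ Real.pi := Real.pi_pos.le
  have hs2' : Real.sqrt 2 ≤ 2 := by
    rw [show (2 : ℝ) = Real.sqrt (2 ^ 2) by rw [Real.sqrt_sq (by norm_num)]]; exact Real.sqrt_le_sqrt (by norm_num)
  have hκ₁0 : 0 ≤ κ₁ := mul_nonneg hsq (abs_nonneg _); have hκ₂0 : 0 ≤ κ₂ := mul_nonneg hsq (abs_nonneg _)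
  have hκ₁2 : κ₁ ≤ 2 := by
    have := mul_le_mul hs2' (abs_inner_slot_le_one A₁ hu₁) (abs_nonneg _) (by norm_num); linarith
  have hκ₂2 : κ₂ ≤ 2 := by
    have := mul_le_mul hs2' (abs_inner_slot_le_one A₂ hu₂) (abs_nonneg _) (by norm_num); linarith
  -- the bottoms of the two grains' stacks differ
  have hA₁₂ : A₁ ≠ A₂ := fun hAA => hsep A₁ hA₁M A₂ hA₂M (coaxial_linear_of_image_eq (by rw [hAA]))
  have hbb : (⟨A₁, u₁, 0⟩ : WalkEntry) ≠ ⟨A₂, u₂, 0⟩ := fun hb => hA₁₂ (congrArg WalkEntry.frame hb)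
  -- the main estimate: the payer sum dominates the tops, up to the flux loss
  have hmain : (κ₁ + κ₂) * Real.pi * ρ ^ 2 - 2 * 2000 * (1 + h) * ρ ≤
      (∑ y ∈ PAY, ((12 : ℝ) - ((X.filter fun q => dist y q = 1).card : ℝ))) := by
    have hPAY0 : 0 ≤ ∑ y ∈ PAY, ((12 : ℝ) - ((X.filter fun q => dist y q = 1).card : ℝ)) :=
      Finset.sum_nonneg fun y _ => by
        have h'' : ((X.filter fun q => dist y q = 1).card : ℝ) ≤ 12 := by exact_mod_cast hdeg12 y
        linarith
    by_cases hbig : 11 + L ≤ ρ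
    · -- BIG CELL: run the walkers
      have hρs8 : 8 ≤ ρs := by rw [hρs]; linarith
      have hρs0 : 0 ≤ ρs := by linarith
      have hρs17 : ρs + 16 ≤ ρ - 1 := by rw [hρs]; linarith only [hh, hL, hL0]
      have hρsρ : ρs ≤ ρ - 1 := by linarith only [hρs17]
      have hρs2 : ρs ^ 2 ≤ ρ ^ 2 := by nlinarith only [hρs0, hρsρ]
      have hρs3 : ρs ^ 2 ≤ (ρ - 1) ^ 2 := by nlinarith only [hρs0, hρsρ]
      -- the inner samples, tops and end-state maps
      set S₁ := P₁.filter fun p => (-19 : ℝ) ≤ p 2 ∧ p 2 ≤ -19 + 8 ∧ p 0 ^ 2 + p 1 ^ 2 ≤ ρs ^ 2 with hS₁def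
      set S₂ := P₂.filter fun p => (h + 11) ≤ p 2 ∧ p 2 ≤ (h + 11) + 8 ∧ p 0 ^ 2 + p 1 ^ 2 ≤ ρs ^ 2 with hS₂def
      set T₁ := S₁.filter fun p => p + A₁ u₁ ∉ S₁ with hT₁def
      set T₂ := S₂.filter fun p => p + A₂ u₂ ∉ S₂ with hT₂def
      set f₁ : EuclideanSpace ℝ (Fin 3) → EuclideanSpace ℝ (Fin 3) × List WalkEntry :=
        fun p => walkRun X e₃ N (p + A₁ u₁, [⟨A₁, u₁, 0⟩]) with hf₁
      set f₂ : EuclideanSpace ℝ (Fin 3) → EuclideanSpace ℝ (Fin 3) × List WalkEntry :=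
        fun p => walkRun X (-e₃) N (p + A₂ u₂, [⟨A₂, u₂, 0⟩]) with hf₂
      have hS₁mem : ∀ p, p ∈ S₁ ↔ (p ∈ P₁ ∧ (-19 : ℝ) ≤ p 2 ∧ p 2 ≤ -19 + 8 ∧ p 0 ^ 2 + p 1 ^ 2 ≤ ρs ^ 2) :=
        fun p => by rw [hS₁def, Finset.mem_filter]
      have hS₂mem : ∀ p, p ∈ S₂ ↔ (p ∈ P₂ ∧ (h + 11) ≤ p 2 ∧ p 2 ≤ (h + 11) + 8 ∧ p 0 ^ 2 + p 1 ^ 2 ≤ ρs ^ 2) :=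
        fun p => by rw [hS₂def, Finset.mem_filter]
      have hS₁ : ∀ p, p ∈ S₁ ↔ (p ∈ (fun q => A₁ q + t₁) '' fccStacking 1 (Real.sqrt (2 / 3)) ∧
          (-19 : ℝ) ≤ p 2 ∧ p 2 ≤ -19 + 8 ∧ p 0 ^ 2 + p 1 ^ 2 ≤ ρs ^ 2) := by
        intro p
        rw [hS₁def, Finset.mem_filter, hP₁]
        constructor
        · rintro ⟨⟨hΛ, -, -, -⟩, h1, h2, h3⟩; exact ⟨hΛ, by linarith only [h1], by linarith only [h2], h3⟩
        · rintro ⟨hΛ, h1, h2, h3⟩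
          exact ⟨⟨hΛ, by linarith only [h1], by linarith only [h2], by linarith only [h3, hρs2]⟩, h1, h2, h3⟩
      have hS₂ : ∀ p, p ∈ S₂ ↔ (p ∈ (fun q => A₂ q + t₂) '' fccStacking 1 (Real.sqrt (2 / 3)) ∧
          (h + 11) ≤ p 2 ∧ p 2 ≤ (h + 11) + 8 ∧ p 0 ^ 2 + p 1 ^ 2 ≤ ρs ^ 2) := by
        intro p
        rw [hS₂def, Finset.mem_filter, hP₂]
        constructor
        · rintro ⟨⟨hΛ, -, -, -⟩, h1, h2, h3⟩; exact ⟨hΛ, by linarith only [h1], by linarith only [h2], h3⟩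
        · rintro ⟨hΛ, h1, h2, h3⟩
          exact ⟨⟨hΛ, by linarith only [h1, hh], by linarith only [h2], by linarith only [h3, hρs2]⟩, h1, h2, h3⟩
      -- the tops counts
      obtain ⟨Ea, Eb, hEa, hEb, hdet, hframe, -⟩ := exists_frame_of_mem_fccSlots hu₁
      have hT₁ := tops_ge_lineCount A₁ t₁ (-19) 8 ρs (by norm_num) hρs8 S₁ hS₁ Ea Eb u₁ hEa hEb
        (norm_eq_one_of_mem_fccSlots hu₁) hdet hframe
      obtain ⟨Ea', Eb', hEa', hEb', hdet', hframe', -⟩ := exists_frame_of_mem_fccSlots hu₂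
      have hT₂ := tops_ge_lineCount A₂ t₂ (h + 11) 8 ρs (by norm_num) hρs8 S₂ hS₂ Ea' Eb' u₂ hEa' hEb'
        (norm_eq_one_of_mem_fccSlots hu₂) hdet' hframe'
      have hT₁' : κ₁ * Real.pi * ρs ^ 2 - 10 * Real.sqrt 2 * Real.pi * ρs ≤ (T₁.card : ℝ) := by rw [hT₁def]; exact hT₁
      have hT₂' : κ₂ * Real.pi * ρs ^ 2 - 10 * Real.sqrt 2 * Real.pi * ρs ≤ (T₂.card : ℝ) := by rw [hT₂def]; exact hT₂
      have hflux : ∀ κ : ℝ, 0 ≤ κ → κ ≤ 2 → κ * Real.pi * ρ ^ 2 - 2000 * (1 + h) * ρ ≤ κ * Real.pi * ρs ^ 2 - 10 * Real.sqrt 2 * Real.pi * ρs :=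
        fun κ hκ0 hκ2 => flux_loss_inner_disc hκ0 hκ2 hh hρ0 (by rw [hρs]) hρs0 hρsρ
      have hT₁'' : κ₁ * Real.pi * ρ ^ 2 - 2000 * (1 + h) * ρ ≤ (T₁.card : ℝ) := le_trans (hflux κ₁ hκ₁0 hκ₁2) hT₁'
      have hT₂'' : κ₂ * Real.pi * ρ ^ 2 - 2000 * (1 + h) * ρ ≤ (T₂.card : ℝ) := le_trans (hflux κ₂ hκ₂0 hκ₂2) hT₂'
      -- lateral bookkeeping
      have hlat_of : ∀ (y₀ y : EuclideanSpace ℝ (Fin 3)) (p : EuclideanSpace ℝ (Fin 3)) (v : EuclideanSpace ℝ (Fin 3)),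
          y₀ = p + v → ‖v‖ = 1 → p 0 ^ 2 + p 1 ^ 2 ≤ ρs ^ 2 → ‖y - y₀‖ ≤ L → y 0 ^ 2 + y 1 ^ 2 ≤ (ρ - 2) ^ 2 := by
        intro y₀ y p v hy₀ hv hp3 hd
        have h1 := sqrt_lateral_add_le y₀ (y - y₀); rw [add_sub_cancel] at h1
        have h2 := sqrt_lateral_add_le p v; rw [hv, ← hy₀] at h2
        have h3 : Real.sqrt (p 0 ^ 2 + p 1 ^ 2) ≤ ρs := by rw [← Real.sqrt_sq hρs0]; exact Real.sqrt_le_sqrt hp3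
        have h4 : Real.sqrt (y 0 ^ 2 + y 1 ^ 2) ≤ ρ - 2 := by rw [hρs] at h3; linarith only [h1, h2, h3, hd, hL]
        have h7 := pow_le_pow_left₀ (Real.sqrt_nonneg (y 0 ^ 2 + y 1 ^ 2)) h4 2
        rwa [Real.sq_sqrt (by positivity : (0 : ℝ) ≤ y 0 ^ 2 + y 1 ^ 2)] at h7
      have hsq_of_sqrt : ∀ (p : EuclideanSpace ℝ (Fin 3)), Real.sqrt (p 0 ^ 2 + p 1 ^ 2) ≤ ρ - 1 →
          p 0 ^ 2 + p 1 ^ 2 ≤ (ρ - 1) ^ 2 := by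
        intro p hp
        have h7 := pow_le_pow_left₀ (Real.sqrt_nonneg (p 0 ^ 2 + p 1 ^ 2)) hp 2
        rwa [Real.sq_sqrt (by positivity : (0 : ℝ) ≤ p 0 ^ 2 + p 1 ^ 2)] at h7
      -- GRAIN 1: fullness of the sample, end data, injectivity
      have hfull₁ : ∀ p ∈ S₁, p ∈ X ∧ ∀ w ∈ fccSlots, p + A₁ w ∈ X := by
        intro p hpS
        obtain ⟨hpΛ, hp1, hp2, hp3⟩ := (hS₁ p).1 hpS
        exact ⟨hP₁X ((hS₁mem p).1 hpS).1, fun w hw => hP₁X (inner_sample_full_window A₁ t₁ P₁ (-(2 * 10)) (-10) ρ hρ1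
          hP₁ hpΛ (by linarith only [hp1]) (by linarith only [hp2]) (by linarith only [hp3, hρs3]) hw)⟩
      have hH₁ : ∀ q ∈ X, ⟪q, e₃⟫_ℝ ≤ h + 20 := fun q hq => by rw [he₃i]; linarith only [(hcell q hq).2.1]
      have hend₁ : ∀ t ∈ T₁, (f₁ t).1 ∈ PAY ∧ deg (f₁ t).1 ≤ 11 ∧ WalkInv X e₃ (f₁ t) ∧ StackWF e₃ (f₁ t).2 ∧
          (f₁ t).2.getLast? = some ⟨A₁, u₁, 0⟩ ∧ (∃ e rest, (f₁ t).2 = e :: rest ∧ WalkCertified12 X (f₁ t).1 e) ∧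
          ∀ e ∈ (f₁ t).2, e.frame ∈ M₁ := by
        intro p hp
        have hpS : p ∈ S₁ := by rw [hT₁def] at hp; exact (Finset.mem_filter.1 hp).1
        obtain ⟨hpΛ, hp1, hp2, hp3⟩ := (hS₁ p).1 hpS
        obtain ⟨hpX, hfull⟩ := hfull₁ p hpS
        have hy0X : p + A₁ u₁ ∈ X := hfull u₁ hu₁
        have hy02 : -20 ≤ (p + A₁ u₁) 2 := by linarith only [(hcell _ hy0X).1]
        have hNh : 8 * (h + 20 - ⟪p + A₁ u₁, e₃⟫_ℝ) < 3 * (N : ℝ) := by rw [he₃i]; linarith only [hN, hy02, hh]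
        have hI₀ : WalkInv X e₃ (p + A₁ u₁, [⟨A₁, u₁, 0⟩]) := walkInv_start A₁ hpX hfull hu₁ hsteep₁
        obtain ⟨hyX, hydeg, hrise, hdisp⟩ := grainWalk_end hX hs₀ hcert he₃n hH₁ A₁ hpX hfull hu₁ hsteep₁ hNh
        have hfw : walkEnd X e₃ N (p + A₁ u₁) [⟨A₁, u₁, 0⟩] = (f₁ p).1 := rfl; have hfw' : walkRun X e₃ N (p + A₁ u₁, [⟨A₁, u₁, 0⟩]) = f₁ p := rfl
        rw [hfw] at hyX hydeg hrise hdisp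
        have hy0eq : (p + A₁ u₁) 2 = p 2 + ⟪A₁ u₁, e₃⟫_ℝ := by rw [PiLp.add_apply, ← he₃i (A₁ u₁)]
        rw [he₃i] at hdisp
        have hlat2 := hlat_of (p + A₁ u₁) (f₁ p).1 p (A₁ u₁) rfl
          (by rw [LinearIsometryEquiv.norm_map, norm_eq_one_of_mem_fccSlots hu₁]) hp3
          (by rw [hL]; linarith only [hdisp, hy02])
        have hvalid := walkRun_valid hX hs₀ hcert he₃n N hI₀ (stackWF_start e₃ A₁ u₁)
        have hlast₁ : (f₁ p).2.getLast? = some ⟨A₁, u₁, 0⟩ := by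
          rw [← hfw', walkRun_getLast? hX hs₀ hcert he₃n N _ hI₀]; rfl
        have hfrM : ∀ e ∈ (f₁ p).2, e.frame ∈ M₁ := hM₁ (f₁ p).2 hvalid.1.2.1 hvalid.2 hlast₁
        have hnothigh := stackWalk_end_not_high_sep hX hs₀ hcert A₂ t₂ P₂ 10 h ρ (by linarith only [hρ]) hP₂X'
          (fun q hq => (hcell q hq).2.1) hP₂ he₃n hH₁ hI₀ hNh
          (fun e' he' hco => hsep e'.frame (hfrM e' (by rw [← hfw']; exact he')) A₂ hA₂M
            (coaxial_linear_of_image_eq hco)) hlat2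
        rw [hfw'] at hnothigh
        have hylat : (f₁ p).1 0 ^ 2 + (f₁ p).1 1 ^ 2 ≤ (ρ - 1) ^ 2 := le_trans hlat2 (by nlinarith only [hρ])
        refine ⟨?_, hydeg, hvalid.1, hvalid.2, hlast₁, ?_, hfrM⟩
        · rw [hPAY, Finset.mem_filter]
          refine ⟨hyX, by show deg _ ≠ 12; exact fun h12 => by simp only [hdeg] at h12; omega, ?_, le_of_lt hnothigh⟩
          rw [inner_sub_left, he₃i, he₃i] at hrise
          by_contra hlow; push Not at hlow
          have hsqrt0 : 0 ≤ Real.sqrt 2 / 2 := by positivity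
          exact not_unsaturated_in_slab A₁ t₁ (-(2 * 10)) (-10) ρ hρ1 X P₁ hX hP₁X hP₁ hyX
            (by linarith only [hrise, hy0eq, hp1, hsteep₁, hsqrt0]) (by linarith only [hlow]) hylat hydeg
        · rw [← hfw']
          exact walkRun_certified12 hX hs₀ hcert he₃n hI₀ ⟨⟨A₁, u₁, 0⟩, [], rfl, Or.inl ⟨by simpa using hpX,
            fun w hw => by simp only [add_sub_cancel_right]; exact hfull w hw⟩⟩ N
      have hinj₁ : ∀ t ∈ T₁, ∀ t' ∈ T₁, f₁ t = f₁ t' → t = t' := by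
        intro t ht t' ht' hft; rw [hT₁def, Finset.mem_filter] at ht ht'
        refine walkRun_start_injective hX hs₀ hcert he₃n A₁ t₁ hu₁ hsteep₁ S₁ (hlo := -19) (Hd := -11) (ρ' := ρ - 1)
          hρs0 (fun p hp => ?_) (fun p hp => (hfull₁ p hp).2) (fun p hpX hpΛ hlo hhi hlat w hw => ?_)
          (by linarith only [hρs17])
          (sample_interval A₁ t₁ P₁ S₁ hρs0 (by linarith only [hρsρ]) (by norm_num) (by norm_num) hP₁ hS₁mem hu₁)
          ht.1 ht.2 ht'.1 ht'.2 hft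
        · obtain ⟨hpΛ, hp1, hp2, hp3⟩ := (hS₁ p).1 hp
          exact ⟨(hfull₁ p hp).1, hpΛ, by rw [he₃i]; exact hp1, by rw [he₃i]; linarith only [hp2], hp3⟩
        · rw [he₃i] at hlo hhi
          exact hP₁X (inner_sample_full_window A₁ t₁ P₁ (-(2 * 10)) (-10) ρ hρ1 hP₁ hpΛ (by linarith only [hlo])
            (by linarith only [hhi]) (hsq_of_sqrt p hlat) hw)
      -- GRAIN 2
      have hfull₂ : ∀ p ∈ S₂, p ∈ X ∧ ∀ w ∈ fccSlots, p + A₂ w ∈ X := by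
        intro p hpS
        obtain ⟨hpΛ, hp1, hp2, hp3⟩ := (hS₂ p).1 hpS
        exact ⟨hP₂X' ((hS₂mem p).1 hpS).1, fun w hw => hP₂X' (inner_sample_full_window A₂ t₂ P₂ (h + 10) (h + 2 * 10) ρ
          hρ1 hP₂ hpΛ (by linarith only [hp1]) (by linarith only [hp2]) (by linarith only [hp3, hρs3]) hw)⟩
      have hH₂ : ∀ q ∈ X, ⟪q, -e₃⟫_ℝ ≤ 20 := fun q hq => by rw [inner_neg_right, he₃i]; linarith only [(hcell q hq).1]
      have hend₂ : ∀ t ∈ T₂, (f₂ t).1 ∈ PAY ∧ deg (f₂ t).1 ≤ 11 ∧ WalkInv X (-e₃) (f₂ t) ∧ StackWF (-e₃) (f₂ t).2 ∧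
          (f₂ t).2.getLast? = some ⟨A₂, u₂, 0⟩ ∧ (∃ e rest, (f₂ t).2 = e :: rest ∧ WalkCertified12 X (f₂ t).1 e) ∧
          ∀ e ∈ (f₂ t).2, e.frame ∈ M₂ := by
        intro p hp
        have hpS : p ∈ S₂ := by rw [hT₂def] at hp; exact (Finset.mem_filter.1 hp).1
        obtain ⟨hpΛ, hp1, hp2, hp3⟩ := (hS₂ p).1 hpS
        obtain ⟨hpX, hfull⟩ := hfull₂ p hpS
        have hy0X : p + A₂ u₂ ∈ X := hfull u₂ hu₂
        have hy02 : (p + A₂ u₂) 2 ≤ h + 20 := by linarith only [(hcell _ hy0X).2.1]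
        have hy02' : -20 ≤ (p + A₂ u₂) 2 := by linarith only [(hcell _ hy0X).1]
        have hNh : 8 * (20 - ⟪p + A₂ u₂, -e₃⟫_ℝ) < 3 * (N : ℝ) := by rw [inner_neg_right, he₃i]; linarith only [hN, hy02, hh]
        have hI₀ : WalkInv X (-e₃) (p + A₂ u₂, [⟨A₂, u₂, 0⟩]) := walkInv_start A₂ hpX hfull hu₂ hsteep₂'
        obtain ⟨hyX, hydeg, hrise, hdisp⟩ := grainWalk_end hX hs₀ hcert hme₃n hH₂ A₂ hpX hfull hu₂ hsteep₂' hNh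
        have hfw : walkEnd X (-e₃) N (p + A₂ u₂) [⟨A₂, u₂, 0⟩] = (f₂ p).1 := rfl; have hfw' : walkRun X (-e₃) N (p + A₂ u₂, [⟨A₂, u₂, 0⟩]) = f₂ p := rfl
        rw [hfw] at hyX hydeg hrise hdisp
        have hy0eq : (p + A₂ u₂) 2 = p 2 + ⟪A₂ u₂, e₃⟫_ℝ := by rw [PiLp.add_apply, ← he₃i (A₂ u₂)]
        rw [inner_neg_right, he₃i] at hdisp
        have hlat2 := hlat_of (p + A₂ u₂) (f₂ p).1 p (A₂ u₂) rfl
          (by rw [LinearIsometryEquiv.norm_map, norm_eq_one_of_mem_fccSlots hu₂]) hp3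
          (by rw [hL]; linarith only [hdisp, hy02, hy02', hh])
        have hvalid := walkRun_valid hX hs₀ hcert hme₃n N hI₀ (stackWF_start (-e₃) A₂ u₂)
        have hlast₂ : (f₂ p).2.getLast? = some ⟨A₂, u₂, 0⟩ := by
          rw [← hfw', walkRun_getLast? hX hs₀ hcert hme₃n N _ hI₀]; rfl
        have hfrM : ∀ e ∈ (f₂ p).2, e.frame ∈ M₂ := hM₂ (f₂ p).2 hvalid.1.2.1 hvalid.2 hlast₂
        have hnotlow := stackWalk_end_not_low_sep hX hs₀ hcert A₁ t₁ P₁ 10 ρ (by linarith only [hρ]) hP₁X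
          (fun q hq => (hcell q hq).1) hP₁ hme₃n hH₂ hI₀ hNh
          (fun e' he' hco => hsep A₁ hA₁M e'.frame (hfrM e' (by rw [← hfw']; exact he'))
            (coaxial_linear_of_image_eq hco.symm)) hlat2
        rw [hfw'] at hnotlow
        have hylat : (f₂ p).1 0 ^ 2 + (f₂ p).1 1 ^ 2 ≤ (ρ - 1) ^ 2 := le_trans hlat2 (by nlinarith only [hρ])
        refine ⟨?_, hydeg, hvalid.1, hvalid.2, hlast₂, ?_, hfrM⟩
        · rw [hPAY, Finset.mem_filter]
          refine ⟨hyX, by show deg _ ≠ 12; exact fun h12 => by simp only [hdeg] at h12; omega, ?_, ?_⟩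
          · have : (-10 : ℝ) - 2 < (f₂ p).1 2 := hnotlow
            linarith only [this]
          rw [inner_sub_left, inner_neg_right, inner_neg_right, he₃i, he₃i] at hrise
          by_contra hhigh; push Not at hhigh
          have hsqrt0 : 0 ≤ Real.sqrt 2 / 2 := by positivity
          exact not_unsaturated_in_slab A₂ t₂ (h + 10) (h + 2 * 10) ρ hρ1 X P₂ hX hP₂X' hP₂ hyX
            (by linarith only [hhigh]) (by linarith only [hrise, hy0eq, hp2, hsteep₂, hsqrt0]) hylat hydeg
        · rw [← hfw']
          exact walkRun_certified12 hX hs₀ hcert hme₃n hI₀ ⟨⟨A₂, u₂, 0⟩, [], rfl, Or.inl ⟨by simpa using hpX,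
            fun w hw => by simp only [add_sub_cancel_right]; exact hfull w hw⟩⟩ N
      have hinj₂ : ∀ t ∈ T₂, ∀ t' ∈ T₂, f₂ t = f₂ t' → t = t' := by
        intro t ht t' ht' hft; rw [hT₂def, Finset.mem_filter] at ht ht'
        refine walkRun_start_injective hX hs₀ hcert hme₃n A₂ t₂ hu₂ hsteep₂' S₂ (hlo := -(h + 19)) (Hd := -(h + 11))
          (ρ' := ρ - 1) hρs0 (fun p hp => ?_) (fun p hp => (hfull₂ p hp).2) (fun p hpX hpΛ hlo hhi hlat w hw => ?_)
          (by linarith only [hρs17])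
          (sample_interval A₂ t₂ P₂ S₂ hρs0 (by linarith only [hρsρ]) (by linarith only [hh]) (by linarith only [hh])
            hP₂ hS₂mem hu₂)
          ht.1 ht.2 ht'.1 ht'.2 hft
        · obtain ⟨hpΛ, hp1, hp2, hp3⟩ := (hS₂ p).1 hp
          refine ⟨(hfull₂ p hp).1, hpΛ, ?_, ?_, hp3⟩
          · rw [inner_neg_right, he₃i]; linarith only [hp2]
          · rw [inner_neg_right, he₃i]; linarith only [hp1]
        · rw [inner_neg_right, he₃i] at hlo hhi
          exact hP₂X' (inner_sample_full_window A₂ t₂ P₂ (h + 10) (h + 2 * 10) ρ hρ1 hP₂ hpΛ (by linarith only [hhi])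
            (by linarith only [hlo]) (hsq_of_sqrt p hlat) hw)
      -- THE COUNT: per payer ball, `deg + #fibre₁ + #fibre₂ ≤ 12`
      have hpt : ∀ y ∈ PAY, deg y + (T₁.filter fun t => (f₁ t).1 = y).card + (T₂.filter fun t => (f₂ t).1 = y).card ≤ 12 := by
        intro y hy
        set fib₁ := T₁.filter fun t => (f₁ t).1 = y with hfib₁
        set fib₂ := T₂.filter fun t => (f₂ t).1 = y with hfib₂
        by_cases hemp : fib₁ = ∅ ∧ fib₂ = ∅
        · rw [hemp.1, hemp.2, Finset.card_empty]; have := hdeg12 y; omega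
        -- `y` is an end ball: at most eleven contacts
        have hdegy : deg y ≤ 11 := by
          rw [not_and_or] at hemp
          rcases hemp with hne | hne
          · obtain ⟨t, ht⟩ := Finset.nonempty_iff_ne_empty.2 hne
            obtain ⟨htT, hty⟩ := Finset.mem_filter.1 ht; have := (hend₁ t htT).2.1; rw [hty] at this; exact this
          · obtain ⟨t, ht⟩ := Finset.nonempty_iff_ne_empty.2 hne
            obtain ⟨htT, hty⟩ := Finset.mem_filter.1 ht; have := (hend₂ t htT).2.1; rw [hty] at this; exact this
        set ES₁ := fib₁.image f₁ with hES₁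
        set ES₂ := fib₂.image f₂ with hES₂
        have hc₁ : ES₁.card = fib₁.card := Finset.card_image_of_injOn fun t ht t' ht' hft =>
          hinj₁ t (Finset.mem_filter.1 ht).1 t' (Finset.mem_filter.1 ht').1 hft
        have hc₂ : ES₂.card = fib₂.card := Finset.card_image_of_injOn fun t ht t' ht' hft =>
          hinj₂ t (Finset.mem_filter.1 ht).1 t' (Finset.mem_filter.1 ht').1 hft
        have key := card_contacts_add_endStates_le_twelve_sep hX hDS hCP M₁ M₂ hsep hbb
          (z₁ := e₃) (z₂ := -e₃) hdegy ES₁ ES₂ (fun s hs => ?_) (fun s hs => ?_)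
        · rw [hc₁, hc₂] at key; exact key
        · obtain ⟨t, ht, rfl⟩ := Finset.mem_image.1 hs
          obtain ⟨htT, hty⟩ := Finset.mem_filter.1 ht
          obtain ⟨-, -, hI, hW, hlast, hC, hfr⟩ := hend₁ t htT
          rw [hty] at hC; exact ⟨hty, hI, hW, hlast, hC, hfr⟩
        · obtain ⟨t, ht, rfl⟩ := Finset.mem_image.1 hs
          obtain ⟨htT, hty⟩ := Finset.mem_filter.1 ht
          obtain ⟨-, -, hI, hW, hlast, hC, hfr⟩ := hend₂ t htT
          rw [hty] at hC; exact ⟨hty, hI, hW, hlast, hC, hfr⟩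
      -- summing over the payers
      have hsum₁ : T₁.card = ∑ y ∈ PAY, (T₁.filter fun t => (f₁ t).1 = y).card := Finset.card_eq_sum_card_fiberwise fun t ht => (hend₁ t ht).1
      have hsum₂ : T₂.card = ∑ y ∈ PAY, (T₂.filter fun t => (f₂ t).1 = y).card := Finset.card_eq_sum_card_fiberwise fun t ht => (hend₂ t ht).1
      have hcount : (T₁.card : ℝ) + T₂.card ≤ ∑ y ∈ PAY, ((12 : ℝ) - ((X.filter fun q => dist y q = 1).card : ℝ)) := by
        rw [hsum₁, hsum₂]
        push_cast
        rw [← Finset.sum_add_distrib]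
        refine Finset.sum_le_sum fun y hy => ?_
        have := hpt y hy
        have h' : (deg y : ℝ) + ((T₁.filter fun t => (f₁ t).1 = y).card : ℝ) +
            ((T₂.filter fun t => (f₂ t).1 = y).card : ℝ) ≤ 12 := by exact_mod_cast this
        simp only [hdeg] at h'
        linarith
      linarith only [hcount, hT₁'', hT₂'']
    · -- SMALL CELL: the flux is within the error
      push Not at hbig
      have hsmall : (κ₁ + κ₂) * Real.pi * ρ ^ 2 ≤ 2 * 2000 * (1 + h) * ρ := by
        have h1 : (κ₁ + κ₂) * Real.pi ≤ 16 := by nlinarith only [hκ₁0, hκ₂0, hκ₁2, hκ₂2, hπ, hπ0]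
        have h2 : (κ₁ + κ₂) * Real.pi * ρ ^ 2 ≤ 16 * ρ ^ 2 := mul_le_mul_of_nonneg_right h1 (sq_nonneg ρ)
        have h3 : ρ ^ 2 ≤ ρ * (11 + L) := by rw [sq]; exact mul_le_mul_of_nonneg_left hbig.le hρ0
        have hhρ : 0 ≤ h * ρ := mul_nonneg hh hρ0
        rw [hL] at h3; linarith only [h2, h3, hρ0, hhρ]
      linarith only [hsmall, hPAY0]
  rw [hPAY] at hmain
  exact hmain

end Summit.Ventures.Crystal3D.Theorems

end
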